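import Literature.NumberTheory.LFunctions.KMVMollifierDiagonalMainTerm
import Literature.Barriers.Parity.LogarithmicAveraging
import HarnessLib

/-!
# Tools for the `1/ζ²` Riesz mean: Möbius-sum rates, Abel summation on a tail, the hyperbola identity

Supports stmt-Parity-20343 (`PrimeLevelFamEdge.BeyondDiagonalBeatsQuarter`, K_B; line
`diagonal_kernel_split`, registered stub `stub_kernelFormXSq` — the q-free kernel asymptotics of the KMV
second mollified moment at the profile `X²`). A helper; it closes nothing. Namespace
`Summit.Parity.GeneralizedHardyLittlewood.Theorems.BeyondDiagonalBeatsQuarter.KernelFormXSq`. Everything here is PROVED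
(theorems only; no definitions, no named facts). Consumed by `KernelFormXSqRiesz`
(`Σ_{de ≤ z} μ(d)μ(e)/(de)·log²(z/(de)) = 2 + O(1/log² z)`).

* `exp_neg_sqrt_le_div_pow` — `e^{−c√L} ≤ K/(1+L)^k`;
* `abs_sum_moebius_div_le_inv_log_pow` — `Σ_{k≤e} μ(k)/k ≪ (1 + log e)⁻⁶` (from the tree's
  `abs_sum_moebius_div_le_exp_neg_sqrt_log`); `abs_moebiusRiesz_one_sub_one_le` —
  `R₁(y) = 1 + O((1+log y)⁻⁵)` (with `abs_sum_moebius_mul_log_div_add_one_le`);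
  `abs_moebiusRiesz_two_le` — `|R₂(y)| ≤ 2 log y + A` (`abs_moebiusRiesz_sub_le`);
* `sum_Ioc_mul_eq_abel`, `abs_sum_Ioc_mul_le_of_antitone` — Abel summation on a tail `(u, w]`
  against a weight that is nonnegative and antitone there;
* `sum_hyperbola_symm` — Dirichlet's hyperbola identity for a symmetric summand,
  `Σ_{de ≤ Z} F = Σ_{d,e ≤ u} F + 2Σ_{d ≤ u < e ≤ Z/d} F` (`u² ≤ Z < (u+1)²`);
* small inequalities (`one_add_log_le_floor_sqrt`, `abs_log_div_le`, `div_pow_le_div_sq`).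

## References
* H. L. Montgomery, R. C. Vaughan, *Multiplicative Number Theory I*, CUP 2007, §2.1 (hyperbola
  method), §8.1 (8.6)–(8.8). [cite: MontgomeryVaughan2007, §8.1]
«The programme SEARCHES and TYPES; no claim about Landau–Siegel zeros, Theorems 1–2 of
arXiv:2211.02515 or a repaired Margin232 until a kernel theorem says so.»
-/

noncomputable section

open scoped Real ArithmeticFunction.Moebius
open Finset ArithmeticFunction

namespace Summit.Parity.GeneralizedHardyLittlewood.Theorems.BeyondDiagonalBeatsQuarter.KernelFormXSq

open Literature.NumberTheory.LFunctions Literature.NumberTheory.LFunctions.KMV2000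

open MollifierMainTerm (moebiusRiesz abs_moebiusRiesz_sub_le)

/-! ### Elementary tools -/

/-- `e^{−c√L} ≤ K/(1+L)^k` for `L ≥ 0` (`c > 0`), with `K = 2^k (1 + (2k)!/c^{2k})`. [folklore] -/
theorem exp_neg_sqrt_le_div_pow {c : ℝ} (hc : 0 < c) (k : ℕ) :
    ∃ K : ℝ, 0 < K ∧ ∀ L : ℝ, 0 ≤ L →
      Real.exp (-(c * Real.sqrt L)) ≤ K / (1 + L) ^ k := by
  refine ⟨2 ^ k * (1 + ((2 * k).factorial : ℝ) / c ^ (2 * k)), by positivity, fun L hL ↦ ?_⟩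
  set t : ℝ := c * Real.sqrt L with ht
  have ht0 : 0 ≤ t := by positivity
  have hL1 : 0 < 1 + L := by linarith
  rw [le_div_iff₀ (pow_pos hL1 k)]
  -- `(1+L)^k ≤ 2^k max(1, L)^k ≤ 2^k (1 + L^k)` and `L^k = t^{2k}/c^{2k}`
  have hLt : L = t ^ 2 / c ^ 2 := by
    rw [ht, mul_pow, Real.sq_sqrt hL]; field_simp
  have h1 : (1 + L) ^ k ≤ 2 ^ k * (1 + L ^ k) := by
    rcases le_total L 1 with h | h
    · calc (1 + L) ^ k ≤ (1 + 1) ^ k := by gcongr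
        _ = 2 ^ k * 1 := by norm_num
        _ ≤ 2 ^ k * (1 + L ^ k) := by gcongr; linarith [pow_nonneg hL k]
    · calc (1 + L) ^ k ≤ (L + L) ^ k := by gcongr
        _ = 2 ^ k * L ^ k := by rw [← two_mul, mul_pow]
        _ ≤ 2 ^ k * (1 + L ^ k) := by gcongr; linarith
  have h2 : L ^ k * Real.exp (-t) ≤ ((2 * k).factorial : ℝ) / c ^ (2 * k) := by
    have hf := Real.pow_div_factorial_le_exp t ht0 (2 * k)
    have hfac : (0 : ℝ) < (2 * k).factorial := by exact_mod_cast (2 * k).factorial_pos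
    have hexp : 0 < Real.exp t := Real.exp_pos t
    have hLk : L ^ k = t ^ (2 * k) / c ^ (2 * k) := by
      rw [hLt, div_pow, ← pow_mul, ← pow_mul]
    have hkey : t ^ (2 * k) * Real.exp (-t) ≤ (2 * k).factorial := by
      rw [div_le_iff₀ hfac] at hf
      rw [Real.exp_neg, ← div_eq_mul_inv, div_le_iff₀ hexp]
      linarith
    rw [hLk, div_mul_eq_mul_div]
    exact div_le_div_of_nonneg_right hkey (by positivity)
  have hexp1 : Real.exp (-t) ≤ 1 := by
    rw [Real.exp_le_one_iff]; linarith
  calc Real.exp (-t) * (1 + L) ^ k ≤ Real.exp (-t) * (2 ^ k * (1 + L ^ k)) := by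
        gcongr
    _ = 2 ^ k * (Real.exp (-t) + L ^ k * Real.exp (-t)) := by ring
    _ ≤ 2 ^ k * (1 + ((2 * k).factorial : ℝ) / c ^ (2 * k)) := by
        gcongr

/-- `m₀(e) = Σ_{k ≤ e} μ(k)/k ≪ (1 + log e)⁻⁶` for all naturals `e ≥ 1` (from the de la Vallée-Poussin
rate of the tree). [cite: MontgomeryVaughan2007, §8.1 (8.6)] -/
theorem abs_sum_moebius_div_le_inv_log_pow :
    ∃ C : ℝ, 0 < C ∧ ∀ e : ℕ, 1 ≤ e →
      |∑ k ∈ Icc 1 e, (μ k : ℝ) / k| ≤ C / (1 + Real.log e) ^ 6 := by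
  obtain ⟨c, hc, C, hC⟩ := abs_sum_moebius_div_le_exp_neg_sqrt_log
  obtain ⟨K, hK, hKb⟩ := exp_neg_sqrt_le_div_pow hc 6
  have hC0 : 0 ≤ C := by
    have h := (abs_nonneg _).trans (hC 2 le_rfl)
    exact le_of_not_gt fun hneg ↦ by
      linarith [mul_neg_of_neg_of_pos hneg (Real.exp_pos (-c * Real.sqrt (Real.log 2)))]
  refine ⟨max (C * K) 1, by positivity, fun e he ↦ ?_⟩
  rcases eq_or_lt_of_le he with rfl | he2
  · simp only [Icc_self, sum_singleton, Nat.cast_one, ArithmeticFunction.moebius_apply_one,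
      Int.cast_one, div_one, abs_one, Real.log_one, add_zero, one_pow]
    exact le_max_right _ _
  · have he2' : (2 : ℝ) ≤ e := by exact_mod_cast he2
    have hL : 0 ≤ Real.log e := Real.log_nonneg (by linarith)
    have h := hC e he2'
    rw [Nat.floor_natCast, neg_mul] at h
    have hpow : 0 < (1 + Real.log e) ^ 6 := by positivity
    calc |∑ k ∈ Icc 1 e, (μ k : ℝ) / k| ≤ C * Real.exp (-(c * Real.sqrt (Real.log e))) := h
      _ ≤ C * (K / (1 + Real.log e) ^ 6) := mul_le_mul_of_nonneg_left (hKb _ hL) hC0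
      _ = C * K / (1 + Real.log e) ^ 6 := by ring
      _ ≤ max (C * K) 1 / (1 + Real.log e) ^ 6 :=
          div_le_div_of_nonneg_right (le_max_left _ _) hpow.le

/-- `R₁(y) = Σ_{d ≤ y} μ(d)/d·log(y/d) = 1 + O((1 + log y)⁻⁵)` for `y ≥ 1` (from
`Σ μ(d)/d ≪ e^{−c√log}` and `Σ μ(d) log d/d = −1 + O(e^{−c√log})`). [cite: MontgomeryVaughan2007, §8.1 (8.6)–(8.7)] -/
theorem abs_moebiusRiesz_one_sub_one_le :
    ∃ C : ℝ, 0 < C ∧ ∀ y : ℝ, 1 ≤ y →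
      |moebiusRiesz 1 y - 1| ≤ C / (1 + Real.log y) ^ 5 := by
  obtain ⟨c₀, hc₀, C₀, hC₀⟩ := abs_sum_moebius_div_le_exp_neg_sqrt_log
  obtain ⟨c₁, hc₁, C₁, hC₁⟩ := abs_sum_moebius_mul_log_div_add_one_le
  obtain ⟨K₀, hK₀, hK₀b⟩ := exp_neg_sqrt_le_div_pow hc₀ 6
  obtain ⟨K₁, hK₁, hK₁b⟩ := exp_neg_sqrt_le_div_pow hc₁ 5
  have hC₀0 : 0 ≤ C₀ := by
    have h := (abs_nonneg _).trans (hC₀ 2 le_rfl)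
    exact le_of_not_gt fun hneg ↦ by
      linarith [mul_neg_of_neg_of_pos hneg (Real.exp_pos (-c₀ * Real.sqrt (Real.log 2)))]
  have hC₁0 : 0 ≤ C₁ := by
    have h := (abs_nonneg _).trans (hC₁ 2 le_rfl)
    exact le_of_not_gt fun hneg ↦ by
      linarith [mul_neg_of_neg_of_pos hneg (Real.exp_pos (-c₁ * Real.sqrt (Real.log 2)))]
  refine ⟨max (C₀ * K₀ + C₁ * K₁) ((1 + Real.log 2) ^ 5), by positivity, fun y hy ↦ ?_⟩
  have hy0 : 0 < y := by linarith
  have hL : 0 ≤ Real.log y := Real.log_nonneg hy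
  have hpow : 0 < (1 + Real.log y) ^ 5 := by positivity
  -- `R₁(y) = log y · m₀(y) − m₁(y)`
  have hR : moebiusRiesz 1 y = Real.log y * ∑ k ∈ Icc 1 ⌊y⌋₊, (μ k : ℝ) / k -
      ∑ k ∈ Icc 1 ⌊y⌋₊, (μ k : ℝ) * Real.log k / k := by
    unfold moebiusRiesz
    rw [mul_sum, ← sum_sub_distrib]
    refine sum_congr rfl fun d hd ↦ ?_
    have hd0 : (0 : ℝ) < d := by exact_mod_cast (mem_Icc.1 hd).1
    rw [pow_one, Real.log_div hy0.ne' hd0.ne']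
    ring
  rcases lt_or_ge y 2 with hy2 | hy2
  · -- `⌊y⌋ = 1`: `R₁(y) = log y ∈ [0, log 2)`
    have hfl : ⌊y⌋₊ = 1 := by
      rw [Nat.floor_eq_iff hy0.le]; norm_num; exact ⟨hy, hy2⟩
    rw [hR, hfl]
    simp only [Icc_self, sum_singleton, Nat.cast_one, ArithmeticFunction.moebius_apply_one,
      Int.cast_one, div_one, Real.log_one, mul_zero, sub_zero, mul_one]
    have hlog2 : Real.log y ≤ Real.log 2 := Real.log_le_log hy0 hy2.le
    have hl2 : Real.log 2 < 1 := by
      rw [Real.log_lt_iff_lt_exp (by norm_num)]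
      have := Real.exp_one_gt_d9; linarith
    rw [abs_of_nonpos (by linarith)]
    calc -(Real.log y - 1) ≤ 1 := by linarith
      _ ≤ (1 + Real.log 2) ^ 5 / (1 + Real.log y) ^ 5 := by
          rw [le_div_iff₀ hpow, one_mul]
          gcongr
      _ ≤ max (C₀ * K₀ + C₁ * K₁) ((1 + Real.log 2) ^ 5) / (1 + Real.log y) ^ 5 :=
          div_le_div_of_nonneg_right (le_max_right _ _) hpow.le
  · have h0 := hC₀ y hy2
    have h1 := hC₁ y hy2
    rw [neg_mul] at h0 h1
    have e0 := hK₀b _ hL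
    have e1 := hK₁b _ hL
    have hsplit : moebiusRiesz 1 y - 1 =
        Real.log y * ∑ k ∈ Icc 1 ⌊y⌋₊, (μ k : ℝ) / k -
          (∑ k ∈ Icc 1 ⌊y⌋₊, (μ k : ℝ) * Real.log k / k + 1) := by rw [hR]; ring
    rw [hsplit]
    have hLy : Real.log y ≤ 1 + Real.log y := by linarith
    calc |Real.log y * ∑ k ∈ Icc 1 ⌊y⌋₊, (μ k : ℝ) / k -
            (∑ k ∈ Icc 1 ⌊y⌋₊, (μ k : ℝ) * Real.log k / k + 1)|
        ≤ |Real.log y * ∑ k ∈ Icc 1 ⌊y⌋₊, (μ k : ℝ) / k| +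
            |∑ k ∈ Icc 1 ⌊y⌋₊, (μ k : ℝ) * Real.log k / k + 1| := abs_sub _ _
      _ ≤ (1 + Real.log y) * (C₀ * (K₀ / (1 + Real.log y) ^ 6)) +
            C₁ * (K₁ / (1 + Real.log y) ^ 5) := by
          rw [abs_mul, abs_of_nonneg hL]
          gcongr
          · exact h0.trans (mul_le_mul_of_nonneg_left e0 hC₀0)
          · exact h1.trans (mul_le_mul_of_nonneg_left e1 hC₁0)
      _ = (C₀ * K₀ + C₁ * K₁) / (1 + Real.log y) ^ 5 := by
          field_simp
      _ ≤ max (C₀ * K₀ + C₁ * K₁) ((1 + Real.log 2) ^ 5) / (1 + Real.log y) ^ 5 :=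
          div_le_div_of_nonneg_right (le_max_left _ _) hpow.le

/-- `|R₂(y)| ≤ 2 log y + A₂` for `y ≥ 1` (`R₂(y) = 2 log y + O(1)`, the tree's
`abs_moebiusRiesz_sub_le` at `j = 2`). [cite: MontgomeryVaughan2007, §8.1 (8.8)] -/
theorem abs_moebiusRiesz_two_le :
    ∃ A : ℝ, 0 < A ∧ ∀ y : ℝ, 1 ≤ y → |moebiusRiesz 2 y| ≤ 2 * Real.log y + A := by
  obtain ⟨A, hA⟩ := abs_moebiusRiesz_sub_le (show 1 ≤ 2 by norm_num)
  have hA1 := hA 1 le_rfl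
  have hA0 : 0 ≤ A := by
    simp only [Real.log_one] at hA1
    norm_num at hA1
    linarith [abs_nonneg (moebiusRiesz 2 1)]
  refine ⟨2 * A + 1, by positivity, fun y hy ↦ ?_⟩
  have h := hA y hy
  simp only [Nat.cast_ofNat] at h
  norm_num at h
  have hL : 0 ≤ Real.log y := Real.log_nonneg hy
  have h1 : |2 * Real.log y| = 2 * Real.log y := abs_of_nonneg (by linarith)
  calc |moebiusRiesz 2 y| = |(moebiusRiesz 2 y - 2 * Real.log y) + 2 * Real.log y| := by ring_nf
    _ ≤ |moebiusRiesz 2 y - 2 * Real.log y| + |2 * Real.log y| := abs_add_le _ _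
    _ ≤ A * 2 + 2 * Real.log y := by rw [h1]; linarith
    _ ≤ 2 * Real.log y + (2 * A + 1) := by linarith

/-! ### Abel summation on a tail -/

/-- Telescoping: `Σ_{u<e≤w} (φ(e) − φ(e+1)) = φ(u+1) − φ(w+1)`. [folklore] -/
theorem sum_Ioc_sub_succ (φ : ℕ → ℝ) {u w : ℕ} (huw : u ≤ w) :
    ∑ e ∈ Ioc u w, (φ e - φ (e + 1)) = φ (u + 1) - φ (w + 1) := by
  induction w, huw using Nat.le_induction with
  | base => simp
  | succ w huw ih => rw [Finset.sum_Ioc_succ_top huw, ih]; ring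

/-- Abel summation on a tail `(u, w]`, with `A(e) = Σ_{k ≤ e} a(k)`:
`Σ_{u<e≤w} a(e)φ(e) = Σ_{u<e≤w} A(e)(φ(e) − φ(e+1)) + A(w)φ(w+1) − A(u)φ(u+1)`. [folklore] -/
theorem sum_Ioc_mul_eq_abel (a φ : ℕ → ℝ) {u w : ℕ} (huw : u ≤ w) :
    ∑ e ∈ Ioc u w, a e * φ e =
      ∑ e ∈ Ioc u w, (∑ k ∈ Icc 1 e, a k) * (φ e - φ (e + 1)) +
        (∑ k ∈ Icc 1 w, a k) * φ (w + 1) - (∑ k ∈ Icc 1 u, a k) * φ (u + 1) := by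
  induction w, huw using Nat.le_induction with
  | base => simp
  | succ w huw ih =>
    rw [Finset.sum_Ioc_succ_top huw, Finset.sum_Ioc_succ_top huw, ih,
      Finset.sum_Icc_succ_top (by omega)]
    ring

/-- **Abel bound on a tail with an eventually monotone weight.** If `|A(e)| ≤ η` for `u ≤ e ≤ w`,
`φ ≥ 0`, and `φ(e+1) ≤ φ(e)` whenever `u < e`, `e + 1 ≤ w`, then
`|Σ_{u<e≤w} a(e)φ(e)| ≤ η·(2φ(u+1) + 2φ(w+1))`. [folklore] -/
theorem abs_sum_Ioc_mul_le_of_antitone (a φ : ℕ → ℝ) {u w : ℕ} (huw : u ≤ w) {η : ℝ}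
    (hA : ∀ e, u ≤ e → e ≤ w → |∑ k ∈ Icc 1 e, a k| ≤ η) (hφ0 : ∀ e, 0 ≤ φ e)
    (hφ : ∀ e, u < e → e + 1 ≤ w → φ (e + 1) ≤ φ e) :
    |∑ e ∈ Ioc u w, a e * φ e| ≤ η * (2 * φ (u + 1) + 2 * φ (w + 1)) := by
  have hη : 0 ≤ η := (abs_nonneg _).trans (hA u le_rfl huw)
  rcases eq_or_lt_of_le huw with rfl | hlt
  · simp only [Finset.Ioc_self, Finset.sum_empty, abs_zero]
    nlinarith [hφ0 (u + 1)]
  -- `w = w' + 1` with `u ≤ w'`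
  obtain ⟨w', rfl⟩ : ∃ w', w = w' + 1 := ⟨w - 1, by omega⟩
  have huw' : u ≤ w' := by omega
  rw [sum_Ioc_mul_eq_abel a φ huw, Finset.sum_Ioc_succ_top huw']
  set A : ℕ → ℝ := fun e ↦ ∑ k ∈ Icc 1 e, a k with hAdef
  -- the interior terms
  have hint : |∑ e ∈ Ioc u w', A e * (φ e - φ (e + 1))| ≤ η * (φ (u + 1) - φ (w' + 1)) := by
    rw [← sum_Ioc_sub_succ φ huw', Finset.mul_sum]
    refine (Finset.abs_sum_le_sum_abs _ _).trans (Finset.sum_le_sum fun e he ↦ ?_)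
    have he' := Finset.mem_Ioc.1 he
    have hmono : φ (e + 1) ≤ φ e := hφ e he'.1 (by omega)
    rw [abs_mul, abs_of_nonneg (by linarith : 0 ≤ φ e - φ (e + 1))]
    exact mul_le_mul_of_nonneg_right (hA e he'.1.le (by omega)) (by linarith)
  have hlast : |A (w' + 1) * (φ (w' + 1) - φ (w' + 1 + 1))| ≤ η * (φ (w' + 1) + φ (w' + 1 + 1)) := by
    rw [abs_mul]
    refine mul_le_mul (hA _ (by omega) le_rfl) ?_ (abs_nonneg _) hη
    exact (abs_sub _ _).trans (by rw [abs_of_nonneg (hφ0 _), abs_of_nonneg (hφ0 _)])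
  have hbw : |A (w' + 1) * φ (w' + 1 + 1)| ≤ η * φ (w' + 1 + 1) := by
    rw [abs_mul, abs_of_nonneg (hφ0 _)]
    exact mul_le_mul_of_nonneg_right (hA _ (by omega) le_rfl) (hφ0 _)
  have hbu : |A u * φ (u + 1)| ≤ η * φ (u + 1) := by
    rw [abs_mul, abs_of_nonneg (hφ0 _)]
    exact mul_le_mul_of_nonneg_right (hA _ le_rfl huw) (hφ0 _)
  calc |∑ e ∈ Ioc u w', A e * (φ e - φ (e + 1)) + A (w' + 1) * (φ (w' + 1) - φ (w' + 1 + 1)) +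
          A (w' + 1) * φ (w' + 1 + 1) - A u * φ (u + 1)|
      ≤ |∑ e ∈ Ioc u w', A e * (φ e - φ (e + 1))| + |A (w' + 1) * (φ (w' + 1) - φ (w' + 1 + 1))| +
          |A (w' + 1) * φ (w' + 1 + 1)| + |A u * φ (u + 1)| := by
        refine (abs_sub _ _).trans ?_
        gcongr
        exact (abs_add_le _ _).trans (by gcongr; exact abs_add_le _ _)
    _ ≤ η * (φ (u + 1) - φ (w' + 1)) + η * (φ (w' + 1) + φ (w' + 1 + 1)) +
          η * φ (w' + 1 + 1) + η * φ (u + 1) := by gcongr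
    _ = η * (2 * φ (u + 1) + 2 * φ (w' + 1 + 1)) := by ring

/-! ### Dirichlet's hyperbola method for a symmetric summand -/

/-- **Hyperbola identity (symmetric form).** For `F` symmetric, `u² ≤ Z < (u+1)²`:
`Σ_{de ≤ Z} F(d,e) = Σ_{d,e ≤ u} F(d,e) + 2 Σ_{d ≤ u} Σ_{u < e ≤ Z/d} F(d,e)`. [folklore] -/
theorem sum_hyperbola_symm (F : ℕ → ℕ → ℝ) (hF : ∀ d e, F d e = F e d) {Z u : ℕ}
    (hu1 : u * u ≤ Z) (hu2 : Z < (u + 1) * (u + 1)) :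
    ∑ d ∈ Ioc 0 Z, ∑ e ∈ Ioc 0 (Z / d), F d e =
      ∑ d ∈ Ioc 0 u, ∑ e ∈ Ioc 0 u, F d e + 2 * ∑ d ∈ Ioc 0 u, ∑ e ∈ Ioc u (Z / d), F d e := by
  have huZ : u ≤ Z := by nlinarith
  -- for `d ≤ u`: `u ≤ Z/d`; for `d > u`: `Z/d ≤ u`
  have hsmall : ∀ d ∈ Ioc 0 u, u ≤ Z / d := by
    intro d hd
    have hd' := Finset.mem_Ioc.1 hd
    exact (Nat.le_div_iff_mul_le hd'.1).2 (le_trans (Nat.mul_le_mul_left u hd'.2) hu1)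
  have hlarge : ∀ d, u < d → Z / d ≤ u := by
    intro d hd
    have h1 : Z / d ≤ Z / (u + 1) := Nat.div_le_div_left hd (Nat.succ_pos u)
    have h2 : Z / (u + 1) < u + 1 := (Nat.div_lt_iff_lt_mul (Nat.succ_pos u)).2 hu2
    omega
  rw [← Finset.sum_Ioc_consecutive _ (Nat.zero_le u) huZ]
  have hA : ∑ d ∈ Ioc 0 u, ∑ e ∈ Ioc 0 (Z / d), F d e =
      ∑ d ∈ Ioc 0 u, ∑ e ∈ Ioc 0 u, F d e + ∑ d ∈ Ioc 0 u, ∑ e ∈ Ioc u (Z / d), F d e := by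
    rw [← Finset.sum_add_distrib]
    refine Finset.sum_congr rfl fun d hd ↦ ?_
    rw [← Finset.sum_Ioc_consecutive _ (Nat.zero_le u) (hsmall d hd)]
  have hB : ∑ d ∈ Ioc u Z, ∑ e ∈ Ioc 0 (Z / d), F d e =
      ∑ e ∈ Ioc 0 u, ∑ d ∈ Ioc u (Z / e), F d e := by
    refine Finset.sum_comm' fun d e ↦ ?_
    simp only [Finset.mem_Ioc]
    constructor
    · rintro ⟨⟨hud, hdZ⟩, he0, heZ⟩
      have hd0 : 0 < d := by omega
      have hde : e * d ≤ Z := (Nat.le_div_iff_mul_le hd0).1 heZ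
      refine ⟨⟨hud, (Nat.le_div_iff_mul_le he0).2 (by rwa [mul_comm] at hde)⟩, he0, ?_⟩
      exact heZ.trans (hlarge d hud)
    · rintro ⟨⟨hud, hdZ⟩, he0, heu⟩
      have hd0 : 0 < d := by omega
      have hde : d * e ≤ Z := (Nat.le_div_iff_mul_le he0).1 hdZ
      refine ⟨⟨hud, hdZ.trans (Nat.div_le_self Z e)⟩, he0, ?_⟩
      exact (Nat.le_div_iff_mul_le hd0).2 (by rwa [mul_comm] at hde)
  rw [hA, hB, two_mul, add_assoc]
  congr 2
  exact Finset.sum_congr rfl fun e _ ↦ Finset.sum_congr rfl fun d _ ↦ hF d e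

/-- `(1 + log z)/4 ≤ 1 + log ⌊√z⌋` for `z ≥ 1`. [folklore] -/
theorem one_add_log_le_floor_sqrt {z : ℝ} (hz : 1 ≤ z) :
    (1 + Real.log z) / 4 ≤ 1 + Real.log (⌊Real.sqrt z⌋₊ : ℕ) := by
  have hz0 : 0 < z := by linarith
  have hs1 : 1 ≤ Real.sqrt z := by rw [Real.le_sqrt zero_le_one hz0.le]; simpa using hz
  have hu1 : 1 ≤ ⌊Real.sqrt z⌋₊ := Nat.le_floor (by simpa using hs1)
  have hu1' : (1 : ℝ) ≤ (⌊Real.sqrt z⌋₊ : ℕ) := by exact_mod_cast hu1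
  have hlogz : Real.log z = 2 * Real.log (Real.sqrt z) := by
    rw [Real.log_sqrt hz0.le]; ring
  have hl2 : Real.log 2 < 0.7 := by have := Real.log_two_lt_d9; linarith
  rcases lt_or_ge z 4 with h4 | h4
  · have hlog4 : Real.log z ≤ Real.log 4 := Real.log_le_log hz0 h4.le
    have hlog4' : Real.log 4 = 2 * Real.log 2 := by
      rw [show (4 : ℝ) = 2 ^ 2 by norm_num, Real.log_pow]; ring
    have : 0 ≤ Real.log (⌊Real.sqrt z⌋₊ : ℕ) := Real.log_nonneg hu1'
    linarith
  · have hs2 : 2 ≤ Real.sqrt z := by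
      rw [Real.le_sqrt (by norm_num) hz0.le]; norm_num; exact h4
    have hu : Real.sqrt z / 2 ≤ (⌊Real.sqrt z⌋₊ : ℕ) := by
      have := Nat.lt_floor_add_one (Real.sqrt z)
      linarith
    have hlogu : Real.log (Real.sqrt z) - Real.log 2 ≤ Real.log (⌊Real.sqrt z⌋₊ : ℕ) := by
      rw [← Real.log_div (by linarith) (by norm_num)]
      exact Real.log_le_log (by linarith) hu
    have hlz : 0 ≤ Real.log z := Real.log_nonneg hz
    linarith

/-- `|log(z/q)| ≤ 1 + log z` for `1 ≤ q ≤ 2z`. [folklore] -/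
theorem abs_log_div_le {z q : ℝ} (hz : 1 ≤ z) (hq1 : 1 ≤ q) (hq2 : q ≤ 2 * z) :
    |Real.log (z / q)| ≤ 1 + Real.log z := by
  have hz0 : 0 < z := by linarith
  have hq0 : 0 < q := by linarith
  have hlz : 0 ≤ Real.log z := Real.log_nonneg hz
  rw [Real.log_div hz0.ne' hq0.ne', abs_le]
  have hlq0 : 0 ≤ Real.log q := Real.log_nonneg hq1
  have hlq : Real.log q ≤ Real.log 2 + Real.log z := by
    rw [← Real.log_mul (by norm_num) hz0.ne']; exact Real.log_le_log hq0 hq2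
  have hl2 : Real.log 2 < 1 := by have := Real.log_two_lt_d9; linarith
  constructor <;> linarith

/-- `X/(1+L)^k ≤ X/(1+L)^2` for `X, L ≥ 0`, `k ≥ 2`. [folklore] -/
theorem div_pow_le_div_sq {X L : ℝ} (hX : 0 ≤ X) (hL : 0 ≤ L) {k : ℕ} (hk : 2 ≤ k) :
    X / (1 + L) ^ k ≤ X / (1 + L) ^ 2 :=
  div_le_div_of_nonneg_left hX (by positivity) (pow_le_pow_right₀ (by linarith) hk)

end Summit.Parity.GeneralizedHardyLittlewood.Theorems.BeyondDiagonalBeatsQuarter.KernelFormXSq
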